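import Literature.AlgebraicGeometry.Milne1999.SpecialLefschetzGroupInvariantsSpBlocksMultiplicity
import Literature.AlgebraicGeometry.Milne1999.SpecialLefschetzGroupInvariantsSymplecticPowers
import HarnessLib

/-!
# Milne 1999, Cor. 4.5 / Thm. 3.2 / Prop. 3.6 (a) with multiplicity and several blocks: the `S`-invariants
# of ALL POWERS of a complex abelian variety with real multiplication OF ANY RANK are Lefschetz classes

Family `hodge`, layer `Literature/AlgebraicGeometry/Milne1999`, namespace
`Literature.AlgebraicGeometry.Milne1999` (D-0022). THEOREMS ONLY (no definition, no named fact, no `sorry`;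
D-0026, net debt 0). Written for the cell `pub-hodgecm2` (COR-CM), seat `lit-milne`, binder table
`HOME/lit/milne.md` rows M2/M4 (the record `Milne1999_specialLefschetzGroup_invariants_le` of
`Milne1999/LefschetzGroup`: Cor. 4.5 with Thm. 4.4 and Thm. 3.2, whose CONCLUSION is proved here on a new
locus; its wording is untouched and it is NOT discharged). Generalises BOTH
`Milne1999/SpecialLefschetzGroupInvariantsRealMultiplicationPowers` (the same hypotheses with
`dim V_σ ≤ 2`, symplectic PLANES, `Sp₂ = SL₂` by weights) and `Milne1999/SpecialLefschetzGroupInvariantsSymplecticPowers`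
(ONE block: `φ` a scalar) to eigenspaces `V_σ` of ANY common dimension: `S(A)(ℂ) = ∏_σ Sp(V_σ)` with
`Sp` of arbitrary rank and arbitrary multiplicity `r = N + 1` — through the several-blocks criterion
`Milne1999/SpecialLefschetzGroupInvariantsSpBlocksMultiplicity` and the coloured tensor FFT for `Sp`
(`RepresentationTheory/ClassicalInvariants/SymplecticTensorFFTColoured`). This closes the "NOT here:
symplectic blocks of rank `≥ 4` (real multiplication with `[E:ℚ] < dim A`)" of `…RealMultiplicationPowers`
for fields (all `V_σ` of the same dimension `2 dim A / [E:ℚ]`).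

## Source, verbatim

J. S. Milne, *Lefschetz classes on abelian varieties*, Duke Math. J. 96 (1999) 639–675
[`paper:doi-10-1215-s0012-7094-99-09620-5`, held; PDF page = printed page − 638]:

* §1 p. 643: "For any positive integer `r`, `V(A^r) = rV(A)`, and the diagonal action of `C(A)` on `rV(A)`
  identifies `C(A)` with `C(A^r)`"; p. 644: "`S(A)` is the largest algebraic subgroup of `Sp(e_D)` whose
  elements commute with the endomorphisms of `A`".
* §2 pp. 646–649: the decomposition `V = ⊕_σ V_σ` over the embeddings of the centre and
  "`S(A)_{/k^{al}} = ∏_σ S_σ`", `S_σ = Sp` for type I.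
* p. 654 "The symplectic group" (Fulton–Harris F.13); Prop. 3.6 (a) (p. 655): "`(⋀^*(rH))^G = k[(⊗² rH)^G]`
  all `r ≥ 1` […] (a) `G = Sp(φ)`"; p. 656: "`(⋀^*(⊕ rH_σ))^{∏S_σ} = ⊗_σ (⋀^* rH_σ)^{S_σ}`. Hence it suffices
  to show that each of the `k`-algebras `(⋀^* rH_σ)^{S_σ}` is generated by tensors of degree 2";
  Props. 3.3–3.4, Remark 3.7; Cor. 4.5, Cor. 4.7 (p. 659), Prop. 4.8 (p. 660).

## What is proved (complex `A`, Betti cohomology, the tree's carriers)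

Hypotheses as in `…RealMultiplicationPowers` — `φ ∈ End(A)` with `C(A) ⊗ ℂ = ` the commutant of `φ^*`
(`hC`), `φ^*` diagonalizable (`hdiag`) and self-adjoint for the polarization form of `h` (`hJQ`) — with the
bound `dim V_σ ≤ 2` replaced by: all eigenspaces of `φ^*` have the same dimension `N₁` (`hn`).

* §1 `exists_uniformBlockEigenbasis` — an eigenbasis `b(ℓ, k)`, `ℓ ∈ Fin N₁`, `k ∈ Fin m` (distinct eigenvalues
  `μ_k`), with `B`-orthogonal blocks; `bilin_apply_family_eq_transpose_mul_mul` (`B(u eᵢ, u eⱼ) = (MᵀGM)ᵢⱼ`);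
  `repr_apply_eq_zero_of_commute`, `apply_basis_eq_sum_block` — an endomorphism commuting with `φ^*`
  preserves every block.
* §2 **`mem_divisorClassesSpan_powSucc_of_forall_exteriorPullback_eq_of_selfAdjoint_of_finrank_eigenspace_eq`**
  — the `S(ℂ)`-form for every power `A^{N+1}`: the several-blocks criterion on the letters `prⱼ^* b(ℓ, k)`
  (colour `k`, `Ω_k` = Gram matrix of `λ ∘ Q_h` on `V_k`, nondegenerate since `det (⊕ Ω_k) = ∏ det Ω_k ≠ 0`);
  for `g ∈ Sp(Ω_{k₀})` the automorphism with matrix `diag(1, …, g, …, 1)` (`Matrix.blockDiagonal`) preserves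
  `Q_h` and commutes with `φ^*`, so lies in `S(A)(ℂ)`, and its diagonal image (`diagPow`) acts on the slots of
  colour `k₀` by `g`; the crossed classes `∑ (Ω_k⁻¹)_{ac} prⱼ^* b(a,k) ⌣ pr_{j'}^* b(c,k)` are divisor
  classes (`SymplecticPowers.sum_smul_cross_mem_span_rational_oneOne`) because
  `θ_k = ∑ (Ω_k⁻¹)_{ac} b(a,k) ⌣ b(c,k) ∈ B¹(A) ⊗ ℂ`: every `u ∈ S(A)(ℂ)` preserves `V_k` (§1) and `Q_h`,
  hence fixes `θ_k` (`M Ω⁻¹ Mᵀ = Ω⁻¹`), and Prop. 3.3 (`S(ℂ)`-form, `mem_hodgeClassSpan_of_forall_exteriorPullback_eq`).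
* **`exists_polarization_invariants_le_powSucc_of_selfAdjoint_of_finrank_eigenspace_eq`** (the package
  consumed by `SpecialLefschetzGroupInvariantsFiniteProducts`),
  **`specialLefschetzGroup_invariants_le_powSucc_of_selfAdjoint_of_finrank_eigenspace_eq`** — the CONCLUSION of
  the record for every power `A^{N+1}`; `…_of_isIsogenous_powSucc_…` (Cor. 4.7); Cor. 4.5 as an equality of
  sets; Prop. 4.8 (c) ⇒ (a) on `A^{N+1}`.

NOT here: eigenspaces of different dimensions (an `A` isogenous to a product of non-isogenous factors is
covered by `…FiniteProducts` from the packages of the factors); types II/III/IV blocks; the record itself.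

## References

* [Milne1999LefschetzClasses] J. S. Milne, Lefschetz classes on abelian varieties, Duke Math. J. 96 (1999)
  639–675: §1 pp. 643–644, §2 pp. 646–649, p. 654, Props. 3.3–3.4, 3.6 (a), Remark 3.7, p. 656, Thm. 4.4,
  Cor. 4.5, Cor. 4.7 (p. 659), Prop. 4.8 (p. 660).
* [GoodmanWallachGTM255] R. Goodman, N. R. Wallach, GTM 255 (2009), §1.1.2, Thm. 5.3.3 (2), Thm. 5.3.5,
  (5.34), §4.1.1.
* [LangeBirkenhake1992] H. Lange, Ch. Birkenhake, Complex Abelian Varieties (1992), §5.3 (endomorphism types).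
-/

noncomputable section

open scoped BigOperators Matrix
open CategoryTheory
open Literature.AlgebraicTopology.SingularHomology
open Literature.AlgebraicGeometry.HodgeTheory
open Literature.AlgebraicGeometry.Motives
open Literature.AlgebraicGeometry.VanGeemen1994 (pullbackOne hodgeClassSpan)
open Literature.Barriers.HodgeConjecture (divisorClassesSpan divisorMonomials mem_divisorMonomials_zero)
open Literature.Geometry.Kaehler (lefschetzPow)
open Literature.RepresentationTheory.GeneralLinear
open Literature.RepresentationTheory.ClassicalInvariants
open Literature.NumberTheory.DiophantineGeometry

namespace Literature.AlgebraicGeometry.Milne1999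

/-! ### §1 The eigenbasis with blocks of one size; block matrices -/

section Blocks

variable {V : Type*} [AddCommGroup V] [Module ℂ V] [FiniteDimensional ℂ V]

/-- **An eigenbasis adapted to `V = ⊕_σ V_σ` with all blocks of the same size** (`V_σ` the eigenspaces of a
diagonalisable `J`, pairwise `B`-orthogonal when `J` is `B`-self-adjoint; Milne §2: "`V = ⊕ V_σ`" over the
embeddings `σ` of the centre): if every eigenspace has dimension `N₁` there are `m` distinct eigenvalues
`μ_k` and a basis `b(ℓ, k)` (`ℓ ∈ Fin N₁`) with `J b(ℓ,k) = μ_k b(ℓ,k)` and `B(b(ℓ,k), b(ℓ',k')) = 0` for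
`k ≠ k'`. [cite: Milne1999LefschetzClasses, §2 pp. 646–649 (decomposition over the centre)] -/
theorem exists_uniformBlockEigenbasis (B : LinearMap.BilinForm ℂ V) (J : Module.End ℂ V)
    (hJ : ⨆ μ, J.eigenspace μ = ⊤) (hJB : ∀ x y, B (J x) y = B x (J y)) (N₁ : ℕ)
    (hn : ∀ μ, J.HasEigenvalue μ → Module.finrank ℂ (J.eigenspace μ) = N₁) :
    ∃ (m : ℕ) (μ : Fin m → ℂ) (b : Module.Basis (Fin N₁ × Fin m) ℂ V), Function.Injective μ ∧
      (∀ ℓ k, J (b (ℓ, k)) = μ k • b (ℓ, k)) ∧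
      (∀ ℓ ℓ' k k', k ≠ k' → B (b (ℓ, k)) (b (ℓ', k')) = 0) := by
  classical
  set m : ℕ := Fintype.card J.Eigenvalues with hm_def
  set e : J.Eigenvalues ≃ Fin m := Fintype.equivFin J.Eigenvalues with he_def
  set μ : Fin m → ℂ := fun k => ((e.symm k : J.Eigenvalues) : ℂ) with hμ_def
  have hμinj : Function.Injective μ := fun k k' h => e.symm.injective (Subtype.ext h)
  set E : Fin m → Submodule ℂ V := fun k => J.eigenspace (μ k) with hE_def
  have hind : iSupIndep E := (Module.End.eigenspaces_iSupIndep J).comp hμinj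
  have htop : iSup E = ⊤ := by
    refine eq_top_iff.2 ?_
    rw [← hJ]
    refine iSup_le fun ν => ?_
    by_cases hν : J.HasEigenvalue ν
    · have : J.eigenspace ν = E (e ⟨ν, hν⟩) := by
        simp only [hE_def, hμ_def, Equiv.symm_apply_apply]
        rfl
      rw [this]
      exact le_iSup E _
    · rw [Module.End.hasEigenvalue_iff, not_ne_iff] at hν
      rw [hν]
      exact bot_le
  have hint : DirectSum.IsInternal E := DirectSum.isInternal_submodule_of_iSupIndep_of_iSup_eq_top hind htop
  have hdim : ∀ k, Module.finrank ℂ (E k) = N₁ := fun k => hn (μ k) (e.symm k).2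
  let bk : ∀ k, Module.Basis (Fin N₁) ℂ (E k) := fun k => (Module.finBasis ℂ (E k)).reindex (finCongr (hdim k))
  let b₀ : Module.Basis (Σ _ : Fin m, Fin N₁) ℂ V := hint.collectedBasis bk
  let b : Module.Basis (Fin N₁ × Fin m) ℂ V :=
    b₀.reindex ((Equiv.sigmaEquivProd (Fin m) (Fin N₁)).trans (Equiv.prodComm (Fin m) (Fin N₁)))
  have hb : ∀ ℓ k, b (ℓ, k) = b₀ ⟨k, ℓ⟩ := fun ℓ k => by
    rw [Module.Basis.reindex_apply]
    rfl
  have hmem : ∀ ℓ k, b (ℓ, k) ∈ E k := fun ℓ k => by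
    rw [hb]
    exact hint.collectedBasis_mem bk ⟨k, ℓ⟩
  refine ⟨m, μ, b, hμinj, fun ℓ k => Module.End.mem_eigenspace_iff.1 (hmem ℓ k), fun ℓ ℓ' k k' hkk' => ?_⟩
  exact apply_eq_zero_of_mem_eigenspace_of_ne B J hJB (hμinj.ne hkk') (hmem ℓ k) (hmem ℓ' k')

omit [FiniteDimensional ℂ V] in
/-- Bilinear expansion `B(∑ αₐ xₐ, ∑ β_c y_c) = ∑∑ αₐ β_c B(xₐ, y_c)`. [folklore] -/
private theorem bilin_sum_smul_sum_smul (B : LinearMap.BilinForm ℂ V) {n : ℕ} (α β : Fin n → ℂ)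
    (x y : Fin n → V) :
    B (∑ a, α a • x a) (∑ c, β c • y c) = ∑ a, ∑ c, α a * β c * B (x a) (y c) := by
  simp only [map_sum, map_smul, LinearMap.sum_apply, LinearMap.smul_apply, smul_eq_mul, Finset.mul_sum]
  rw [Finset.sum_comm]
  refine Finset.sum_congr rfl fun a _ => Finset.sum_congr rfl fun c _ => ?_
  ring

omit [FiniteDimensional ℂ V] in
/-- `B(u eᵢ, u eⱼ) = (Mᵀ G M)ᵢⱼ` for a family `e` with Gram matrix `G` and `u eᵢ = ∑ₐ Mₐᵢ eₐ`
(`γᵗ J γ = J`, Goodman–Wallach §1.1.2, (5.34)). [cite: GoodmanWallachGTM255, §1.1.2 and (5.34)] -/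
theorem bilin_apply_family_eq_transpose_mul_mul (B : LinearMap.BilinForm ℂ V) {n : ℕ} (e : Fin n → V)
    {u : V → V} {M : Matrix (Fin n) (Fin n) ℂ} (hu : ∀ i, u (e i) = ∑ a, M a i • e a) (i j : Fin n) :
    B (u (e i)) (u (e j)) = (Mᵀ * (Matrix.of fun a c => B (e a) (e c)) * M) i j := by
  rw [hu, hu, bilin_sum_smul_sum_smul, Matrix.mul_apply]
  simp_rw [Matrix.mul_apply, Matrix.transpose_apply, Matrix.of_apply, Finset.sum_mul]
  rw [Finset.sum_comm]
  refine Finset.sum_congr rfl fun c _ => Finset.sum_congr rfl fun a _ => ?_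
  ring

variable {N₁ m : ℕ}

omit [FiniteDimensional ℂ V] in
/-- **An endomorphism commuting with the block-scalar `J` preserves the blocks**: the coordinates of `u b(ℓ,k)`
outside block `k` vanish (distinct eigenvalues). [cite: Milne1999LefschetzClasses, §2 p. 646 (`α = α₁ ⊕ ⋯ ⊕ α_t`)] -/
theorem repr_apply_eq_zero_of_commute (b : Module.Basis (Fin N₁ × Fin m) ℂ V) (J : Module.End ℂ V)
    {μ : Fin m → ℂ} (hμ : Function.Injective μ) (hJb : ∀ ℓ k, J (b (ℓ, k)) = μ k • b (ℓ, k))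
    {u : V → V} (huJ : ∀ v, J (u v) = u (J v)) (hul : ∀ (c : ℂ) (v : V), u (c • v) = c • u v)
    (ℓ : Fin N₁) (k : Fin m) (ℓ' : Fin N₁) {k' : Fin m} (hk : k' ≠ k) :
    b.repr (u (b (ℓ, k))) (ℓ', k') = 0 := by
  classical
  set v := u (b (ℓ, k)) with hv
  have hJv : J v = μ k • v := by rw [hv, huJ, hJb, hul]
  have hexp : J v = ∑ i, (μ i.2 * b.repr v i) • b i := by
    conv_lhs => rw [← b.sum_repr v, map_sum]
    refine Finset.sum_congr rfl fun i _ => ?_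
    obtain ⟨ℓ₀, k₀⟩ := i
    rw [map_smul, hJb, smul_smul, mul_comm]
  have h1 : b.repr (J v) (ℓ', k') = μ k' * b.repr v (ℓ', k') := by
    rw [hexp, b.repr_sum_self]
  have h2 : b.repr (J v) (ℓ', k') = μ k * b.repr v (ℓ', k') := by
    rw [hJv, map_smul, Finsupp.smul_apply, smul_eq_mul]
  have h3 : (μ k' - μ k) * b.repr v (ℓ', k') = 0 := by rw [sub_mul, ← h1, ← h2, sub_self]
  rcases mul_eq_zero.1 h3 with h | h
  · exact absurd (hμ (sub_eq_zero.1 h)) hk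
  · exact h

omit [FiniteDimensional ℂ V] in
/-- Hence `u b(ℓ,k) = ∑_{ℓ'} M^k_{ℓ'ℓ} b(ℓ',k)` with `M^k_{ℓ'ℓ}` the block-`k` coordinates.
[cite: Milne1999LefschetzClasses, §2 p. 646 (`α = α₁ ⊕ ⋯ ⊕ α_t`)] -/
theorem apply_basis_eq_sum_block (b : Module.Basis (Fin N₁ × Fin m) ℂ V) (J : Module.End ℂ V)
    {μ : Fin m → ℂ} (hμ : Function.Injective μ) (hJb : ∀ ℓ k, J (b (ℓ, k)) = μ k • b (ℓ, k))
    {u : V → V} (huJ : ∀ v, J (u v) = u (J v)) (hul : ∀ (c : ℂ) (v : V), u (c • v) = c • u v)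
    (ℓ : Fin N₁) (k : Fin m) :
    u (b (ℓ, k)) = ∑ ℓ', b.repr (u (b (ℓ, k))) (ℓ', k) • b (ℓ', k) := by
  classical
  conv_lhs => rw [← b.sum_repr (u (b (ℓ, k))), Fintype.sum_prod_type]
  refine Finset.sum_congr rfl fun ℓ' _ => ?_
  rw [Finset.sum_eq_single k]
  · intro k' _ hk'
    rw [repr_apply_eq_zero_of_commute b J hμ hJb huJ hul ℓ k ℓ' hk', zero_smul]
  · intro h
    exact absurd (Finset.mem_univ k) h

end Blocks

/-! ### §2 Prop. 3.6 (a) with multiplicity for the powers of an abelian variety with real multiplication by a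
diagonalisable self-adjoint `φ` whose eigenspaces have one dimension -/

section Main

variable {A : AbelianVariety ℂ}

/-- **Milne 1999, Prop. 3.6 (a) with multiplicity and several blocks, `S(ℂ)`-form, for the powers of a complex
abelian variety with real multiplication of any rank.** Let `φ ∈ End(A)` act diagonalizably on `H¹(A(ℂ); ℂ)`
with `C(A) ⊗ ℂ` the commutant of `φ^*`, all eigenspaces `V_σ` of the same dimension, and `φ^*` self-adjoint
for a polarization `h`. Then `S(A)(ℂ) = ∏_σ Sp(V_σ)`, and for every `N` every class of
`H^{2p}(A^{N+1}(ℂ); ℂ)` fixed by `⋀^{2p}u` for all `u ∈ S(A^{N+1})(ℂ) =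
unitaryCentralizerGroup (A.powSucc N) (Σᵢ prᵢ^* h)` lies in `Dᵖ(A^{N+1}) ⊗ ℂ` ("`(⋀^*(⊕ rH_σ))^{∏S_σ} =
⊗_σ (⋀^* rH_σ)^{S_σ}` […] each […] generated by tensors of degree 2", `r = N + 1`). Proof: the several-blocks
criterion `mem_divisorClassesSpan_of_forall_exteriorPullback_eq_of_spBlocks` on the letters `prⱼ^* b(ℓ, σ)`
(`b` an eigenbasis, colour = eigenvalue, `Ω_σ` = Gram matrix of `λQ_h` on `V_σ`), the block elements
`diag(1, …, g, …, 1)`, `g ∈ Sp(Ω_σ)`, of `S(A)(ℂ)` and their diagonal images in `S(A^{N+1})(ℂ)`, and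
`θ_σ = ∑ (Ω_σ⁻¹)_{ac} b(a,σ) ⌣ b(c,σ) ∈ B¹(A) ⊗ ℂ` by Prop. 3.3 (`S(ℂ)`-form: every `u ∈ S(A)(ℂ)` preserves
`V_σ` and `Q_h|V_σ`). The planes case (`dim V_σ ≤ 2`) is `…RealMultiplicationPowers`, the one-block case
(`φ` a scalar) is `…SymplecticPowers`.
[cite: Milne1999LefschetzClasses, §1 p. 643, §2 pp. 646–649, Props. 3.3–3.4, 3.6 (a), p. 656, Cor. 4.5 (p. 659)]
[cite: GoodmanWallachGTM255, Thm. 5.3.3 (2), Thm. 5.3.5] -/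
theorem mem_divisorClassesSpan_powSucc_of_forall_exteriorPullback_eq_of_selfAdjoint_of_finrank_eigenspace_eq
    (φ : A ⟶ A) (hC : centralizerAlgebra A = Subalgebra.centralizer ℂ {pullbackOne A φ})
    (hdiag : ⨆ μ : ℂ, Module.End.eigenspace (pullbackOne A φ) μ = ⊤) (N₁ : ℕ)
    (hn : ∀ μ : ℂ, Module.End.HasEigenvalue (pullbackOne A φ) μ →
      Module.finrank ℂ (Module.End.eigenspace (pullbackOne A φ) μ) = N₁)
    {h : complexBetti A.X 2} (hQ : IsRationalClass h)
    (hK : ∃ s : ℝ, 0 < s ∧ IsKaehlerClass A.dim A.X ((s : ℂ) • h))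
    (hJQ : ∀ x y : complexBetti A.X 1,
      polarizationPairingOne A.X h (A.dim - 1) (pullbackOne A φ x) y =
        polarizationPairingOne A.X h (A.dim - 1) x (pullbackOne A φ y))
    (N p : ℕ) (x : complexBetti (A.powSucc N).X (2 * p))
    (hx : ∀ u ∈ unitaryCentralizerGroup (A.powSucc N) (powPolarizationClass A h N),
      exteriorPullback (AbelianVariety.hasExteriorCohomologyH1_complexPoints (A.powSucc N))
        (u : complexBetti (A.powSucc N).X 1 →ₗ[ℂ] complexBetti (A.powSucc N).X 1) (2 * p) x = x) :
    x ∈ divisorClassesSpan (A.powSucc N).X (A.powSucc N).dim p := by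
  classical
  haveI : Module.Finite ℂ (complexBetti A.X 1) := abelianVarietyCohomologyExteriorH1_holds.finite_one A
  haveI : Module.Finite ℂ (complexBetti (A.powSucc N).X 1) :=
    abelianVarietyCohomologyExteriorH1_holds.finite_one (A.powSucc N)
  have hX := AbelianVariety.hasExteriorCohomologyH1_complexPoints (A.powSucc N)
  have hXA := AbelianVariety.hasExteriorCohomologyH1_complexPoints A
  -- degree `0`: everything is a multiple of the unit class
  rcases Nat.eq_zero_or_pos p with rfl | hp1
  · have htop : Submodule.span ℂ (Set.range (cupPowOne ℂ (ComplexPoints (A.powSucc N).X) 0)) = ⊤ :=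
      hX.span_range_cupPowOne 0
    have hrange : Set.range (cupPowOne ℂ (ComplexPoints (A.powSucc N).X) 0) =
        {singularCohomology.one ℂ (ComplexPoints (A.powSucc N).X)} := by
      ext c
      simp only [Set.mem_range, cupPowOne_zero, Set.mem_singleton_iff]
      exact ⟨fun ⟨_, e⟩ => e.symm, fun e => ⟨fun i => Fin.elim0 i, e.symm⟩⟩
    have hx' : x ∈ Submodule.span ℂ (Set.range (cupPowOne ℂ (ComplexPoints (A.powSucc N).X) 0)) := by
      rw [htop]; exact Submodule.mem_top
    rw [hrange] at hx'
    refine Submodule.span_mono (fun c hc => ?_) hx'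
    rw [Set.mem_singleton_iff] at hc
    exact mem_divisorMonomials_zero.2 hc
  -- dimension `0`: no classes in positive degree
  rcases Nat.eq_zero_or_pos A.dim with hA | hA0
  · haveI : Subsingleton (complexBetti (A.powSucc N).X (2 * p)) :=
      hX.subsingleton_of_lt (by rw [AbelianVariety.finrank_complexBetti_one, dim_powSucc_eq_succ_mul, hA]; omega)
    rw [Subsingleton.elim x 0]
    exact Submodule.zero_mem _
  -- the polarization data of `A`
  obtain ⟨s, hs, hKs⟩ := hK
  have hnd := eq_zero_of_forall_polarizationPairingOne_eq_zero_of_isKaehlerClass_smul' hs.ne' hKs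
  have hh : h ∈ hodgeClassSpan A.dim A.X 1 := mem_hodgeClassSpan_one_of_isKaehlerClass_smul hQ hs.ne' hKs
  obtain ⟨Bf, hBalt, hBnd, lam, hlam, hBapp⟩ := exists_bilinForm_isAlt_nondegenerate (A := A) hnd
  set J : Module.End ℂ (complexBetti A.X 1) := pullbackOne A φ with hJ_def
  have hJB : ∀ x y, Bf (J x) y = Bf x (J y) := fun x y => by rw [hBapp, hBapp, hJ_def, hJQ]
  -- the eigenbasis with blocks of size `N₁`, and the block Gram matrices
  obtain ⟨m, μ, b₁, hμ, hJb, hcr⟩ := exists_uniformBlockEigenbasis Bf J hdiag hJB N₁ hn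
  let Ωk : Fin m → Matrix (Fin N₁) (Fin N₁) ℂ := fun k => Matrix.of fun ℓ ℓ' => Bf (b₁ (ℓ, k)) (b₁ (ℓ', k))
  have hΩk : ∀ k ℓ ℓ', Ωk k ℓ ℓ' = Bf (b₁ (ℓ, k)) (b₁ (ℓ', k)) := fun _ _ _ => rfl
  have hGram : LinearMap.BilinForm.toMatrix b₁ Bf = Matrix.blockDiagonal Ωk := by
    ext ⟨ℓ, k⟩ ⟨ℓ', k'⟩
    rw [LinearMap.BilinForm.toMatrix_apply, Matrix.blockDiagonal_apply']
    split_ifs with hkk'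
    · subst hkk'
      rfl
    · exact hcr ℓ ℓ' k k' hkk'
  have hdetk : ∀ k, (Ωk k).det ≠ 0 := by
    have hdet : (LinearMap.BilinForm.toMatrix b₁ Bf).det ≠ 0 :=
      (LinearMap.BilinForm.nondegenerate_iff_det_ne_zero b₁).1 hBnd
    rw [hGram, Matrix.det_blockDiagonal] at hdet
    exact fun k => (Finset.prod_ne_zero_iff.1 hdet) k (Finset.mem_univ k)
  have hΩa : ∀ k, (Matrix.toBilin' (Ωk k)).IsAlt := fun k =>
    isAlt_toBilin'_of_forall_eq_neg fun a c => by rw [hΩk, hΩk, ← hBalt.neg_eq]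
  have hΩn : ∀ k, (Matrix.toBilin' (Ωk k)).Nondegenerate := fun k =>
    LinearMap.BilinForm.nondegenerate_toBilin'_iff_det_ne_zero.2 (hdetk k)
  -- membership in `S(A)(ℂ)`: commute with `J` (hence with `End(A)`, by `hC`) and preserve `Bf`
  have hmem : ∀ u : complexBetti A.X 1 ≃ₗ[ℂ] complexBetti A.X 1,
      J * (u : Module.End ℂ (complexBetti A.X 1)) = (u : Module.End ℂ (complexBetti A.X 1)) * J →
      (∀ a c, Bf (u a) (u c) = Bf a c) → u ∈ unitaryCentralizerGroup A h := by
    intro u hcomm hu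
    refine ⟨mem_centralizerGroup_iff_coe_mem.2 ?_, fun a c => hlam (by rw [← hBapp, ← hBapp, hu a c])⟩
    rw [hC, Subalgebra.mem_centralizer_iff]
    intro g hg
    rw [Set.mem_singleton_iff] at hg
    rw [hg]
    exact hcomm
  -- conversely an element of `S(A)(ℂ)` commutes with `J` and preserves `Bf`
  have hofmem : ∀ u ∈ unitaryCentralizerGroup A h,
      (∀ v, J (u v) = u (J v)) ∧ ∀ a c, Bf (u a) (u c) = Bf a c := by
    intro u hu
    refine ⟨fun v => ?_, fun a c => by rw [hBapp, hBapp, hu.2]⟩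
    have hc := mem_centralizerGroup_iff_coe_mem.1 hu.1
    rw [hC, Subalgebra.mem_centralizer_iff] at hc
    have e := hc J (Set.mem_singleton J)
    exact LinearMap.congr_fun e v
  -- the letters of `H¹(A^{N+1})`: `prⱼ^* b(ℓ, k)`, slots `(j, k)`, colour `k`
  let y : (Fin (N + 1) × Fin m) × Fin N₁ → complexBetti (A.powSucc N).X 1 := fun sl =>
    complexBetti.map (powSlots A N sl.1.1).hom.hom.hom 1 (b₁ (sl.2, sl.1.2))
  have hy : ∀ j k ℓ, y ((j, k), ℓ) = complexBetti.map (powSlots A N j).hom.hom.hom 1 (b₁ (ℓ, k)) :=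
    fun _ _ _ => rfl
  have hyspan : ⊤ ≤ Submodule.span ℂ (Set.range y) := by
    intro z _
    have hz := mem_span_map_powSlots A N z
    refine (Submodule.span_le.2 ?_) hz
    rintro _ ⟨⟨j, v⟩, rfl⟩
    change complexBetti.map (powSlots A N j).hom.hom.hom 1 v ∈ Submodule.span ℂ (Set.range y)
    rw [← b₁.sum_repr v, map_sum]
    refine Submodule.sum_mem _ fun a _ => ?_
    rw [map_smul]
    obtain ⟨ℓ, k⟩ := a
    exact Submodule.smul_mem _ _ (Submodule.subset_span ⟨((j, k), ℓ), rfl⟩)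
  have h2dim : 2 * A.dim = N₁ * m := by
    rw [← AbelianVariety.finrank_complexBetti_one, Module.finrank_eq_card_basis b₁, Fintype.card_prod,
      Fintype.card_fin, Fintype.card_fin]
  have hcard : Fintype.card ((Fin (N + 1) × Fin m) × Fin N₁) =
      Module.finrank ℂ (complexBetti (A.powSucc N).X 1) := by
    rw [AbelianVariety.finrank_complexBetti_one, dim_powSucc_eq_succ_mul,
      show 2 * ((N + 1) * A.dim) = (N + 1) * (2 * A.dim) by ring, h2dim]
    simp only [Fintype.card_prod, Fintype.card_fin]
    ring
  obtain ⟨bB, hbB⟩ : ∃ bB : Module.Basis ((Fin (N + 1) × Fin m) × Fin N₁) ℂ (complexBetti (A.powSucc N).X 1),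
      ∀ sl, bB sl = y sl :=
    ⟨basisOfTopLeSpanOfCardEqFinrank y hyspan hcard, fun sl => by rw [coe_basisOfTopLeSpanOfCardEqFinrank]⟩
  let col : Fin (N + 1) × Fin m → Fin m := fun t => t.2
  -- THE CRITERION: several symplectic blocks acting diagonally on the slots
  refine mem_divisorClassesSpan_of_forall_exteriorPullback_eq_of_spBlocks bB col Ωk hΩa hΩn
    (unitaryCentralizerGroup (A.powSucc N) (powPolarizationClass A h N))
    (fun k₀ g hg => ?_) (fun t t' htt' => ?_) p x hx
  · -- the block element `diag(1, …, g, …, 1)` of `S(A)(ℂ)` and its diagonal image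
    have hgdet : IsUnit g.det := by
      have hdet := congrArg Matrix.det hg
      rw [Matrix.det_mul, Matrix.det_mul, Matrix.det_transpose] at hdet
      have hsq : g.det * g.det = 1 := by
        have h1 : g.det * g.det * (Ωk k₀).det = 1 * (Ωk k₀).det := by
          rw [one_mul]
          calc g.det * g.det * (Ωk k₀).det = g.det * (Ωk k₀).det * g.det := by ring
            _ = (Ωk k₀).det := hdet
        exact mul_right_cancel₀ (hdetk k₀) h1
      exact IsUnit.of_mul_eq_one _ hsq
    let d : Fin m → Matrix (Fin N₁) (Fin N₁) ℂ := fun k => if k = k₀ then g else 1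
    have hd : ∀ k, (d k)ᵀ * Ωk k * d k = Ωk k := fun k => by
      by_cases hk : k = k₀
      · subst hk
        simp only [d, if_pos rfl]
        exact hg
      · simp only [d, if_neg hk, Matrix.transpose_one, Matrix.one_mul, Matrix.mul_one]
    have hddet : ∀ k, (d k).det ≠ 0 := fun k => by
      by_cases hk : k = k₀
      · subst hk
        simp only [d, if_pos rfl]
        exact hgdet.ne_zero
      · simp only [d, if_neg hk, Matrix.det_one]
        exact one_ne_zero
    let M : Matrix (Fin N₁ × Fin m) (Fin N₁ × Fin m) ℂ := Matrix.blockDiagonal d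
    have hMdet : IsUnit M.det := by
      refine isUnit_iff_ne_zero.2 ?_
      change (Matrix.blockDiagonal d).det ≠ 0
      rw [Matrix.det_blockDiagonal]
      exact Finset.prod_ne_zero_iff.2 fun k _ => hddet k
    let f : complexBetti A.X 1 →ₗ[ℂ] complexBetti A.X 1 := Matrix.toLin b₁ b₁ M
    have hfdet : IsUnit (LinearMap.toMatrix b₁ b₁ f).det := by
      change IsUnit (LinearMap.toMatrix b₁ b₁ (Matrix.toLin b₁ b₁ M)).det
      rw [LinearMap.toMatrix_toLin]
      exact hMdet
    let u₁ : complexBetti A.X 1 ≃ₗ[ℂ] complexBetti A.X 1 := LinearEquiv.ofIsUnitDet hfdet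
    have hu₁ : ∀ ℓ k, u₁ (b₁ (ℓ, k)) = ∑ ℓ', d k ℓ' ℓ • b₁ (ℓ', k) := fun ℓ k => by
      change f (b₁ (ℓ, k)) = _
      change Matrix.toLin b₁ b₁ M (b₁ (ℓ, k)) = _
      rw [Matrix.toLin_self, Fintype.sum_prod_type]
      refine Finset.sum_congr rfl fun ℓ' _ => ?_
      rw [Finset.sum_eq_single k]
      · change Matrix.blockDiagonal d (ℓ', k) (ℓ, k) • b₁ (ℓ', k) = _
        rw [Matrix.blockDiagonal_apply_eq]
      · intro k' _ hk'
        change Matrix.blockDiagonal d (ℓ', k') (ℓ, k) • b₁ (ℓ', k') = 0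
        rw [Matrix.blockDiagonal_apply_ne d ℓ' ℓ hk', zero_smul]
      · intro hk
        exact absurd (Finset.mem_univ k) hk
    have hu₁B : ∀ a c, Bf (u₁ a) (u₁ c) = Bf a c := by
      have H : Bf.comp (u₁ : complexBetti A.X 1 →ₗ[ℂ] complexBetti A.X 1)
          (u₁ : complexBetti A.X 1 →ₗ[ℂ] complexBetti A.X 1) = Bf := by
        refine LinearMap.BilinForm.ext_basis b₁ fun i j => ?_
        obtain ⟨ℓ, k⟩ := i
        obtain ⟨ℓ', k'⟩ := j
        rw [LinearMap.BilinForm.comp_apply, LinearEquiv.coe_coe]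
        by_cases hkk' : k = k'
        · subst hkk'
          rw [bilin_apply_family_eq_transpose_mul_mul Bf (fun a => b₁ (a, k)) (u := ⇑u₁) (M := d k)
            (fun i => hu₁ i k) ℓ ℓ']
          change ((d k)ᵀ * Ωk k * d k) ℓ ℓ' = _
          rw [hd k, hΩk]
        · rw [hu₁, hu₁, bilin_sum_smul_sum_smul, hcr ℓ ℓ' k k' hkk']
          refine Finset.sum_eq_zero fun a _ => Finset.sum_eq_zero fun c _ => ?_
          rw [hcr a c k k' hkk', mul_zero]
      intro a c
      have e := congrArg (fun B' : LinearMap.BilinForm ℂ (complexBetti A.X 1) => B' a c) H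
      simp only [LinearMap.BilinForm.comp_apply, LinearEquiv.coe_coe] at e
      exact e
    have hu₁J : J * (u₁ : Module.End ℂ (complexBetti A.X 1)) = (u₁ : Module.End ℂ (complexBetti A.X 1)) * J := by
      refine b₁.ext fun i => ?_
      obtain ⟨ℓ, k⟩ := i
      rw [Module.End.mul_apply, Module.End.mul_apply, LinearEquiv.coe_coe, hJb, map_smul, hu₁, map_sum,
        Finset.smul_sum]
      refine Finset.sum_congr rfl fun ℓ' _ => ?_
      rw [map_smul, hJb, smul_comm]
    have hu₁S : u₁ ∈ unitaryCentralizerGroup A h := hmem u₁ hu₁J hu₁B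
    refine ⟨diagPow A u₁ N, diagPow_mem_unitaryCentralizerGroup hA0 hu₁S N, fun t ℓ => ?_⟩
    obtain ⟨j, k⟩ := t
    rw [hbB, hy, diagPow_intertwine_right hu₁S.1, hu₁, map_sum]
    refine Finset.sum_congr rfl fun ℓ' _ => ?_
    rw [map_smul, hbB, hy]
  · -- the crossed classes `∑ (Ω_k⁻¹)_{ac} pr_j^* b(a,k) ⌣ pr_{j'}^* b(c,k)` are divisor classes
    obtain ⟨j, k⟩ := t
    obtain ⟨j', k'⟩ := t'
    change k = k' at htt'
    subst htt'
    simp_rw [hbB]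
    change (∑ a, ∑ c, (Ωk k)⁻¹ a c • cupProduct (rfl : 1 + 1 = 2)
      (complexBetti.map (powSlots A N j).hom.hom.hom 1 (b₁ (a, k)))
      (complexBetti.map (powSlots A N j').hom.hom.hom 1 (b₁ (c, k)))) ∈ _
    have hΩunit : IsUnit (Ωk k).det := isUnit_iff_ne_zero.2 (hdetk k)
    have hΩt : (Ωk k)ᵀ = -Ωk k := Matrix.ext fun a c => by
      rw [Matrix.transpose_apply, Matrix.neg_apply]
      exact apply_eq_neg_of_isAlt (hΩa k) a c
    have hΩit : (Ωk k)⁻¹ᵀ = -(Ωk k)⁻¹ := by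
      rw [Matrix.transpose_nonsing_inv, hΩt]
      exact Matrix.inv_eq_left_inv (by rw [neg_mul_neg, Matrix.nonsing_inv_mul _ hΩunit])
    have hΘ : ∀ a c, (Ωk k)⁻¹ c a = -(Ωk k)⁻¹ a c := fun a c => by
      have e := congr_fun (congr_fun hΩit a) c
      rwa [Matrix.transpose_apply, Matrix.neg_apply] at e
    refine sum_smul_cross_mem_span_rational_oneOne (powSlots A N j) (powSlots A N j') (fun a => b₁ (a, k))
      (Ωk k)⁻¹ hΘ ?_
    -- `θ_k = ∑ (Ω_k⁻¹)_{ac} b(a,k) ⌣ b(c,k) ∈ B¹(A) ⊗ ℂ`: fixed by every `u ∈ S(A)(ℂ)` (Prop. 3.3, `S(ℂ)`-form)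
    refine mem_hodgeClassSpan_of_forall_exteriorPullback_eq hh (p := 1) fun u hu => ?_
    obtain ⟨huJ, huB⟩ := hofmem u hu
    set Mk : Matrix (Fin N₁) (Fin N₁) ℂ := Matrix.of fun ℓ' ℓ => b₁.repr (u (b₁ (ℓ, k))) (ℓ', k) with hMk
    have huM : ∀ ℓ, (u : complexBetti A.X 1 →ₗ[ℂ] complexBetti A.X 1) (b₁ (ℓ, k)) =
        ∑ ℓ', Mk ℓ' ℓ • b₁ (ℓ', k) := fun ℓ => by
      rw [LinearEquiv.coe_coe]
      exact apply_basis_eq_sum_block b₁ J hμ hJb (u := ⇑u) huJ (fun c v => map_smul u c v) ℓ k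
    have hMΩ : Mkᵀ * Ωk k * Mk = Ωk k := by
      ext ℓ ℓ'
      have e := bilin_apply_family_eq_transpose_mul_mul Bf (fun a => b₁ (a, k))
        (u := ⇑(u : complexBetti A.X 1 →ₗ[ℂ] complexBetti A.X 1)) (M := Mk) huM ℓ ℓ'
      rw [LinearEquiv.coe_coe, huB] at e
      rw [← e]
      rfl
    have hinv : Mk * (Ωk k)⁻¹ * Mkᵀ = (Ωk k)⁻¹ := mul_inv_mul_transpose_eq hΩunit hMΩ
    change exteriorPullback hXA (u : complexBetti A.X 1 →ₗ[ℂ] complexBetti A.X 1) 2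
      (∑ a, ∑ c, (Ωk k)⁻¹ a c • cupProduct (rfl : 1 + 1 = 2) (b₁ (a, k)) (b₁ (c, k))) = _
    rw [map_sum]
    simp_rw [map_sum, map_smul, exteriorPullback_cupProduct_one_one]
    have key := sum_sum_smul_bilin_eq (cupProduct (rfl : 1 + 1 = 2)) (fun a => b₁ (a, k))
      (u := ⇑(u : complexBetti A.X 1 →ₗ[ℂ] complexBetti A.X 1)) huM (Ωk k)⁻¹
    rw [key, hinv]

/-- **The polarization package of every power `A^{N+1}` of an abelian variety with real multiplication of any
rank (all eigenspaces of `φ^*` of one dimension)** (`0 < dim A`): Milne's class `Σᵢ prᵢ^* h ∈ B¹(A^{N+1}) ⊗ ℂ` with `(Σᵢ prᵢ^* h)^{dim} ≠ 0`,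
`Q` non-degenerate (`SpecialLefschetzGroupOneEqUnitaryCentralizer` §Powers) and the `S(ℂ)`-form above — the
datum consumed by `SpecialLefschetzGroupInvariantsFiniteProducts` (packages of factors ⇒ packages of finite
`Hom`-orthogonal products). [cite: Milne1999LefschetzClasses, §1 p. 643, Prop. 3.4, Cor. 4.5 (p. 659)] -/
theorem exists_polarization_invariants_le_powSucc_of_selfAdjoint_of_finrank_eigenspace_eq (φ : A ⟶ A)
    (hC : centralizerAlgebra A = Subalgebra.centralizer ℂ {pullbackOne A φ})
    (hdiag : ⨆ μ : ℂ, Module.End.eigenspace (pullbackOne A φ) μ = ⊤)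
    (N₁ : ℕ) (hn : ∀ μ : ℂ, Module.End.HasEigenvalue (pullbackOne A φ) μ →
      Module.finrank ℂ (Module.End.eigenspace (pullbackOne A φ) μ) = N₁)
    {h : complexBetti A.X 2} (hQ : IsRationalClass h)
    (hK : ∃ s : ℝ, 0 < s ∧ IsKaehlerClass A.dim A.X ((s : ℂ) • h))
    (hJQ : ∀ x y : complexBetti A.X 1,
      polarizationPairingOne A.X h (A.dim - 1) (pullbackOne A φ x) y =
        polarizationPairingOne A.X h (A.dim - 1) x (pullbackOne A φ y))
    (hA0 : 0 < A.dim) (N : ℕ) :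
    ∃ D : complexBetti (A.powSucc N).X 2, D ∈ hodgeClassSpan (A.powSucc N).dim (A.powSucc N).X 1 ∧
      lefschetzPow D ((A.powSucc N).dim - 1) 2 D ≠ 0 ∧
      (∀ z : complexBetti (A.powSucc N).X 1,
        (∀ y, polarizationPairingOne (A.powSucc N).X D ((A.powSucc N).dim - 1) z y = 0) → z = 0) ∧
      ∀ (a : ℕ) (y : complexBetti (A.powSucc N).X (2 * a)), (∀ u ∈ unitaryCentralizerGroup (A.powSucc N) D,
        exteriorPullback (AbelianVariety.hasExteriorCohomologyH1_complexPoints (A.powSucc N))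
          (u : complexBetti (A.powSucc N).X 1 →ₗ[ℂ] complexBetti (A.powSucc N).X 1) (2 * a) y = y) →
        y ∈ divisorClassesSpan (A.powSucc N).X (A.powSucc N).dim a := by
  obtain ⟨s, hs, hKs⟩ := hK
  have hnd := eq_zero_of_forall_polarizationPairingOne_eq_zero_of_isKaehlerClass_smul' hs.ne' hKs
  have hh : h ∈ hodgeClassSpan A.dim A.X 1 := mem_hodgeClassSpan_one_of_isKaehlerClass_smul hQ hs.ne' hKs
  have htop : lefschetzPow h (A.dim - 1) 2 h ≠ 0 := lefschetzPow_self_ne_zero_of_isKaehlerClass_smul hA0 hKs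
  exact ⟨powPolarizationClass A h N, powPolarizationClass_mem_hodgeClassSpan hh N,
    lefschetzPow_powPolarizationClass_self_ne_zero hA0 htop N,
    eq_zero_of_forall_polarizationPairingOne_powPolarizationClass_eq_zero hA0 htop hnd N,
    fun a y hy => mem_divisorClassesSpan_powSucc_of_forall_exteriorPullback_eq_of_selfAdjoint_of_finrank_eigenspace_eq φ hC hdiag N₁ hn hQ
      ⟨s, hs, hKs⟩ hJQ N a y hy⟩

/-- **The conclusion of the record `Milne1999_specialLefschetzGroup_invariants_le` (Milne 1999, Cor. 4.5 with
Thm. 4.4, Thm. 3.2 and Prop. 3.6 (a) WITH MULTIPLICITY) PROVED for every power of an abelian variety with real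
multiplication of any rank (all eigenspaces of `φ^*` of one dimension)**: for `A` as above and every `N`, every class `x ∈ H^{2p}(A^{N+1}(ℂ); ℂ)` fixed by
every element of `specialLefschetzGroup (dim A^{N+1}) (A^{N+1}).X` lies in `Dᵖ_hom(A^{N+1})_ℂ`
(`A^{N+1} = A.powSucc N`; in dimension `0` there is nothing to prove). [cite: Milne1999LefschetzClasses, Cor. 4.5 and Cor. 4.7 (p. 659), Thm. 3.2, Prop. 3.6 (a), p. 656]
[cite: GoodmanWallachGTM255, Thm. 5.3.3] -/
theorem specialLefschetzGroup_invariants_le_powSucc_of_selfAdjoint_of_finrank_eigenspace_eq (φ : A ⟶ A)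
    (hC : centralizerAlgebra A = Subalgebra.centralizer ℂ {pullbackOne A φ})
    (hdiag : ⨆ μ : ℂ, Module.End.eigenspace (pullbackOne A φ) μ = ⊤)
    (N₁ : ℕ) (hn : ∀ μ : ℂ, Module.End.HasEigenvalue (pullbackOne A φ) μ →
      Module.finrank ℂ (Module.End.eigenspace (pullbackOne A φ) μ) = N₁)
    {h : complexBetti A.X 2} (hQ : IsRationalClass h)
    (hK : ∃ s : ℝ, 0 < s ∧ IsKaehlerClass A.dim A.X ((s : ℂ) • h))
    (hJQ : ∀ x y : complexBetti A.X 1,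
      polarizationPairingOne A.X h (A.dim - 1) (pullbackOne A φ x) y =
        polarizationPairingOne A.X h (A.dim - 1) x (pullbackOne A φ y))
    (N p : ℕ) (x : complexBetti (A.powSucc N).X (2 * p))
    (hx : ∀ g ∈ specialLefschetzGroup (A.powSucc N).dim (A.powSucc N).X, g (2 * p) x = x) :
    x ∈ divisorClassesSpan (A.powSucc N).X (A.powSucc N).dim p := by
  classical
  have hX := AbelianVariety.hasExteriorCohomologyH1_complexPoints (A.powSucc N)
  rcases Nat.eq_zero_or_pos A.dim with hA | hA0
  · -- dimension `0`: `H^{2p}(A^{N+1}) = 0` for `p ≥ 1`, `H⁰ = ℂ · 1`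
    rcases Nat.eq_zero_or_pos p with rfl | hp1
    · have htop : Submodule.span ℂ (Set.range (cupPowOne ℂ (ComplexPoints (A.powSucc N).X) 0)) = ⊤ :=
        hX.span_range_cupPowOne 0
      have hrange : Set.range (cupPowOne ℂ (ComplexPoints (A.powSucc N).X) 0) =
          {singularCohomology.one ℂ (ComplexPoints (A.powSucc N).X)} := by
        ext c
        simp only [Set.mem_range, cupPowOne_zero, Set.mem_singleton_iff]
        exact ⟨fun ⟨_, e⟩ => e.symm, fun e => ⟨fun i => Fin.elim0 i, e.symm⟩⟩
      have hx' : x ∈ Submodule.span ℂ (Set.range (cupPowOne ℂ (ComplexPoints (A.powSucc N).X) 0)) := by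
        rw [htop]; exact Submodule.mem_top
      rw [hrange] at hx'
      refine Submodule.span_mono (fun c hc => ?_) hx'
      rw [Set.mem_singleton_iff] at hc
      exact mem_divisorMonomials_zero.2 hc
    · haveI : Module.Finite ℂ (complexBetti (A.powSucc N).X 1) :=
        abelianVarietyCohomologyExteriorH1_holds.finite_one (A.powSucc N)
      haveI : Subsingleton (complexBetti (A.powSucc N).X (2 * p)) :=
        hX.subsingleton_of_lt (by rw [AbelianVariety.finrank_complexBetti_one, dim_powSucc_eq_succ_mul, hA]; omega)
      rw [Subsingleton.elim x 0]
      exact Submodule.zero_mem _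
  · exact specialLefschetzGroup_invariants_le_of_exists_polarization_invariants_le (dim_powSucc_pos hA0 N)
      (exists_polarization_invariants_le_powSucc_of_selfAdjoint_of_finrank_eigenspace_eq φ hC hdiag N₁ hn hQ hK hJQ hA0 N) p x hx

/-- **The record for every complex abelian variety ISOGENOUS to a power of an abelian variety with real
multiplication of any rank** ("`S(A)` depends only on the isogeny class of `A`", §1 p. 644; Cor. 4.7).
[cite: Milne1999LefschetzClasses, §1 p. 644, Prop. 1.5, Cor. 4.5 and Cor. 4.7 (p. 659)] -/
theorem specialLefschetzGroup_invariants_le_of_isIsogenous_powSucc_of_selfAdjoint_of_finrank_eigenspace_eq {X : AbelianVariety ℂ} (φ : A ⟶ A)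
    (hC : centralizerAlgebra A = Subalgebra.centralizer ℂ {pullbackOne A φ})
    (hdiag : ⨆ μ : ℂ, Module.End.eigenspace (pullbackOne A φ) μ = ⊤)
    (N₁ : ℕ) (hn : ∀ μ : ℂ, Module.End.HasEigenvalue (pullbackOne A φ) μ →
      Module.finrank ℂ (Module.End.eigenspace (pullbackOne A φ) μ) = N₁)
    {h : complexBetti A.X 2} (hQ : IsRationalClass h)
    (hK : ∃ s : ℝ, 0 < s ∧ IsKaehlerClass A.dim A.X ((s : ℂ) • h))
    (hJQ : ∀ x y : complexBetti A.X 1,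
      polarizationPairingOne A.X h (A.dim - 1) (pullbackOne A φ x) y =
        polarizationPairingOne A.X h (A.dim - 1) x (pullbackOne A φ y))
    (hA0 : 0 < A.dim) {N : ℕ} (hXA : AbelianVariety.IsIsogenous X (A.powSucc N)) (p : ℕ)
    (x : complexBetti X.X (2 * p)) (hx : ∀ g ∈ specialLefschetzGroup X.dim X.X, g (2 * p) x = x) :
    x ∈ divisorClassesSpan X.X X.dim p :=
  specialLefschetzGroup_invariants_le_of_isIsogenous_of_exists hXA (dim_powSucc_pos hA0 N)
    (exists_polarization_invariants_le_powSucc_of_selfAdjoint_of_finrank_eigenspace_eq φ hC hdiag N₁ hn hQ hK hJQ hA0 N) p x hx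

/-- **Cor. 4.5 as an equality of sets on the powers of an abelian variety with real multiplication of any rank**:
the `S(A^{N+1})`-invariants of `H^{2p}(A^{N+1}(ℂ); ℂ)` are EXACTLY `Dᵖ_hom(A^{N+1})_ℂ` (the converse inclusion is
definitional, `apply_eq_self_of_mem_specialLefschetzGroup`). [cite: Milne1999LefschetzClasses, Cor. 4.5 (p. 659)] -/
theorem setOf_forall_apply_eq_self_eq_divisorClassesSpan_powSucc_of_selfAdjoint_of_finrank_eigenspace_eq (φ : A ⟶ A)
    (hC : centralizerAlgebra A = Subalgebra.centralizer ℂ {pullbackOne A φ})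
    (hdiag : ⨆ μ : ℂ, Module.End.eigenspace (pullbackOne A φ) μ = ⊤)
    (N₁ : ℕ) (hn : ∀ μ : ℂ, Module.End.HasEigenvalue (pullbackOne A φ) μ →
      Module.finrank ℂ (Module.End.eigenspace (pullbackOne A φ) μ) = N₁)
    {h : complexBetti A.X 2} (hQ : IsRationalClass h)
    (hK : ∃ s : ℝ, 0 < s ∧ IsKaehlerClass A.dim A.X ((s : ℂ) • h))
    (hJQ : ∀ x y : complexBetti A.X 1,
      polarizationPairingOne A.X h (A.dim - 1) (pullbackOne A φ x) y =
        polarizationPairingOne A.X h (A.dim - 1) x (pullbackOne A φ y))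
    (N p : ℕ) :
    {x : complexBetti (A.powSucc N).X (2 * p) |
        ∀ g ∈ specialLefschetzGroup (A.powSucc N).dim (A.powSucc N).X, g (2 * p) x = x} =
      (divisorClassesSpan (A.powSucc N).X (A.powSucc N).dim p : Set _) :=
  Set.Subset.antisymm
    (fun x hx => specialLefschetzGroup_invariants_le_powSucc_of_selfAdjoint_of_finrank_eigenspace_eq φ hC hdiag N₁ hn hQ hK hJQ N p x hx)
    fun _ hx _ hg => apply_eq_self_of_mem_specialLefschetzGroup hg hx

/-- **Milne Prop. 4.8, (c) ⇒ (a) on every power of an abelian variety with real multiplication of any rank,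
record-free**: if `Hg′(A^{N+1}) = S(A^{N+1})` then `A^{N+1}` supports no exotic Hodge class (van Geemen's
`B(A^{N+1}) = D(A^{N+1})`). [cite: Milne1999LefschetzClasses, Prop. 4.8 and Cor. 4.5 (pp. 659–660)] -/
theorem isDivisorGenerated_powSucc_of_hodgeGroup_eq_specialLefschetzGroup_of_selfAdjoint_of_finrank_eigenspace_eq (φ : A ⟶ A)
    (hC : centralizerAlgebra A = Subalgebra.centralizer ℂ {pullbackOne A φ})
    (hdiag : ⨆ μ : ℂ, Module.End.eigenspace (pullbackOne A φ) μ = ⊤)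
    (N₁ : ℕ) (hn : ∀ μ : ℂ, Module.End.HasEigenvalue (pullbackOne A φ) μ →
      Module.finrank ℂ (Module.End.eigenspace (pullbackOne A φ) μ) = N₁)
    {h : complexBetti A.X 2} (hQ : IsRationalClass h)
    (hK : ∃ s : ℝ, 0 < s ∧ IsKaehlerClass A.dim A.X ((s : ℂ) • h))
    (hJQ : ∀ x y : complexBetti A.X 1,
      polarizationPairingOne A.X h (A.dim - 1) (pullbackOne A φ x) y =
        polarizationPairingOne A.X h (A.dim - 1) x (pullbackOne A φ y))
    (N : ℕ)
    (hHg : hodgeGroup (A.powSucc N).dim (A.powSucc N).X =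
      specialLefschetzGroup (A.powSucc N).dim (A.powSucc N).X) :
    IsDivisorGenerated (A.powSucc N) :=
  fun p c hc hpp => specialLefschetzGroup_invariants_le_powSucc_of_selfAdjoint_of_finrank_eigenspace_eq φ hC hdiag N₁ hn hQ hK hJQ N p c
    fun _ hg => apply_eq_self_of_mem_hodgeGroup (hHg ▸ hg) hc hpp


end Main

end Literature.AlgebraicGeometry.Milne1999
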